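import Summits.QuantumFields.YangMills.Theorems.BalabanUVNodesK0AxComplexGaussianRatioFrame

/-!
# K0ᴬ∕K0⁷ — THE COMPLEX-GAUSSIAN RATIO STABILITY BRICK (CGRS) for DEF-1's `gaussRatioC`: numerator, denominator floor, ratio and `R − 1` bounds
(◇ lens-1 g13 NODE v14 «N4-R ⟸ CGRS brick + four model faces»; generic, model-free, Mathlib-only; consumer = FE-2 of ⟨27930⟩ via N4-R of v13.2∕v13.3)

LANDING NOTE (porter ▶ PTC-1 g4, 2026-08-31; AUTHORSHIP = ◇ lens-1 g13 «cauchy-analytic», HOME file `nodeO-cover/LENS-1g13-ComplexGaussianRatio-v1.lean` sha16 db60d35763c9169f · 583 l. · 34 thm +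
2 def (CANDIDATE 1 of g13 — NODE v14 wall N4-R ⟸ «CGRS», the complex-Gaussian ratio stability brick for ★★ DEF-1's total carrier `gaussRatioC` of ✓p824829 `…K0RecordFormatNamesFluctRatioC`)): the
HOME file exceeds the gate's 400-line cap, so it is landed as THREE files by a MECHANICAL split at the §4∕§5 and §6∕§7 boundaries (generator `work/gen/build_split_cgr.py` of this seat; header
docblock, preamble, docstrings, statements and proofs BYTE-IDENTICAL; the only new lines are this paragraph, the chained `import`, and the closing `end`s):
`…Theorems/BalabanUVNodesK0AxComplexGaussianRatioBounds.lean` (PART A = header + §1 real∕imaginary parts (`quadFormR`, `gaussNormR`) + §2 numerator bound + §3 ratio bound from a floor + §4 the `R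
− 1` bound (layer 1)); `…Theorems/BalabanUVNodesK0AxComplexGaussianRatioFrame.lean` (PART B = header + `import …K0AxComplexGaussianRatioBounds` + §5 LAYER 2a congruence frame + §6 LAYER 2b
existence of a congruence frame); `…Theorems/BalabanUVNodesK0AxComplexGaussianRatio.lean` (PART C (◇'s basename; the finals) = header + `import …K0AxComplexGaussianRatioFrame` + §7 LAYER 2c
denominator (`gaussNormC_floor`) + §8 the assembled brick (`norm_gaussRatioC_le_exp_trace`, `gaussNormC_ne_zero`, `norm_gaussRatioC_sub_one_le_trace`)).  THIS FILE: PART C (◇'s basename; the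
finals) = header + `import …K0AxComplexGaussianRatioFrame` + §7 LAYER 2c denominator (`gaussNormC_floor`) + §8 the assembled brick (`norm_gaussRatioC_le_exp_trace`, `gaussNormC_ne_zero`,
`norm_gaussRatioC_sub_one_le_trace`).  ◆ CRIT-1 g38's cut: «(b) CUT — ◇ CANDIDATE 1 (g13) db60d35763c9169f · 583 l. · 34 thm · 2 def → GO VERBATIM `--supports stmt-QuantumFields-27930 --as helper`
(definition lane because of the 2 defs); probe `g38/CGR_probe.lean` (file + 34 `#guard_msgs … #print axioms` std guards) rc 0 · 0 err · 0 warn · 0 sorry; J4 name-dedup 36 names × {Summits,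
Literature, HarnessLib} = 0; stmt-dedup: `quadFormR` no `def` twin (25 inline-sum hits), `gaussNormR` none, `Pᵀ * A * P = 1` ONE hit =
`Summits/HubbardSuperconductivity/…/BalabanIRBirComplexStableXYFixedVolumeGauss.lean` :58 `birGauss_exists_congruence (hA : A.PosDef) (hB : B.IsHermitian)` + :160 `birGauss_integral_ne_zero` — the
SAME congruence-frame ∕ non-vanishing device in ANOTHER summit (not importable across Summits; no FQN clash) ⇒ rider R-i: cited HERE as the in-tree precedent of layer 2's qualitative half; J1′:
`gaussNormR`'s Bochner-junk `0` SAID (:79) and REMOVED where used (`gaussNormC_floor` delivers `0 < gaussNormR (Re M)` ∧ `Integrable …` under `(Re M).PosDef`), every regime hypothesis displayed;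
the floor inequality checked on paper: ‖gaussNormC‖∕gaussNormR = Π_j (1+σ_j²)^{−¼} ≥ Π_j e^{−σ_j²∕4} by `1 + u ≤ e^u`, Σσ_j² = tr(A⁻¹BA⁻¹B) in any congruence frame — TRUE and SECOND ORDER in Im M;
(R-a) `gaussNormC_ne_zero` makes DEF-1's `gaussRatioC` quotient genuine on {Re M ≻ 0}; SAME-WALL: located-A = a KERNEL-PROVED model-free stability brick for the TOTAL carrier, located-B UNCHANGED
= N4-R's model faces + N8b; NOT a tautology, SURVIVES priced S» (nodeO STATUS 2026-08-31T15:07:19Z) and «(1) RE-KEY — CGRS GO ONTO ▶'s SPLIT (INTENT-80): (A) 370ab4c5247b1ad5 · 251 · 11 thm + 2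
def, (B) 6270cc2ca952ba59 · 258 · 13 thm, (C) 7ba7bf850559a672 · 210 · 10 thm (pre-stamp bytes + this paragraph), chain A → B → C each behind its own dry-run ACCEPT; declcmp monolith vs A∕B∕C = 13
SAME · 0 DIFF ∕ 13 SAME · 0 DIFF ∕ 10 SAME · 0 DIFF, 0 ONLY-B, 13+13+10 = 36 = all decls» (2026-08-31T15:10:09Z); `--supports stmt-QuantumFields-27930 --as helper` (NO `--workitem`).  HONEST
(porter): Mathlib-only theorems about parametric Gaussian integrals over `ι → ℝ`; nothing of Bałaban asserted, ported, discharged or refuted; the four MODEL faces and the holomorphy half of N4-R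
are NOT here; `stub_FE`∕`stub_P0C` and the crux ⟨27930⟩ OPEN; K0⁷ 20541 ∕ K0ᴬ 27238 ∕ K1ᴬ ∕ K3ᴬ OPEN — NOTHING of them proved; NODE O 0∕1; COUNT 8∕28 · K 1∕4 UNMOVED; finite 𝕋⁴ at fixed ε — NOT
continuum ∕ OS ∕ Clay; the Yang–Mills mass gap is NOT proved by any of this.  ERRATUM (gate lint, mechanical, declared): the HOME file's bib key `Brydges1986Course` does not exist in
`lean/references.bib`; the tree's key for the SAME source (D. C. Brydges, «A short course on cluster expansions», Les Houches 1984 Session XLIII, North-Holland 1986, pp. 129–183) is `Brydges1986`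
— PART B's first dry-run BOUNCED `lint` on it (15:11Z), so in PARTS B and C every occurrence of `Brydges1986Course` is replaced by `Brydges1986` (1 in the header docblock, 6 in §5–§6, 7 in §7–§8;
nothing else touched); PART A landed before the bounce with the old key in non-leading cite positions (cosmetic, same source).

[I] = [Balaban1987RG1], [II] = [Balaban1988RG2Cluster], [Br] = [Brydges1986].

WHAT.  For DEF-1's TOTAL carriers `gaussIntC χ M E`, `gaussNormC M`, `gaussRatioC χ M E` (✓p824829 `…K0RecordFormatNamesFluctRatioC`: a complex matrix `M` over a finite index type `ι`,
evaluated at REAL points, Lebesgue reference measure) this file PROVES the absolute-value half of print's «the analytically continued expectation is holomorphic and bounded by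
`e^{O(1)|X|}` on the polydisc `|s_□| ≤ e^{κ}`» ([II] (1.13)–(1.14) p.5; [Br] §3), as a MODEL-FREE brick with every regime hypothesis displayed:
* LAYER 1 (§1–§4, inequalities from a denominator floor): `norm_gaussIntegrand` — `‖χ(x)·exp(−½·quadC M x + E x)‖ = |χ x|·exp(−½·quadFormR (Re M) x + Re (E x))` (the imaginary parts
  cost NOTHING in modulus); ★ (ii) `norm_gaussIntC_le` — `0 ≤ χ ≤ 1`, `Re E ≤ η` on `{χ ≠ 0}` ⟹ `‖gaussIntC χ M E‖ ≤ e^{η}·gaussNormR (Re M)`; ★ (iii) `norm_gaussRatioC_le_exp` — plus a floor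
  `e^{−τ}·gaussNormR (Re M) ≤ ‖gaussNormC M‖` ⟹ `‖gaussRatioC χ M E‖ ≤ e^{η+τ}`; ★ (iv) `norm_gaussRatioC_sub_one_le` — plus `‖exp(E x) − 1‖ ≤ η₁` on `{χ ≠ 0}` and a Gaussian TAIL budget
  `∫(1−χ)e^{−½quadFormR} ≤ T·gaussNormR` ⟹ `‖gaussRatioC χ M E − 1‖ ≤ e^{τ}(η₁ + T)`.
* LAYER 2 (§5–§7, what `τ` IS): ★★ `gaussNormC_eq_of_frame` — in a congruence frame `P` (real, invertible) bringing `½·quadC M` to `Σ_j b_j w_j²`, `Re b_j > 0`: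
  `gaussNormC M = |det P|·Π_j (π∕b_j)^{½}` (Lebesgue measure under `toLin' P`, `Real.map_matrix_volume_pi_eq_smul_volume_pi`, + Mathlib's one-dimensional complex Gaussians
  `GaussianFourier.integral_cexp_neg_sum_mul_add`); ★★ `exists_congruenceFrame` — for real symmetric `A ≻ 0`, `B`: `∃ P σ, PᵀAP = 1 ∧ PᵀBP = diagonal σ` (spectral theorem twice, Mathlib's
  `eigenvectorUnitary`); `sum_sq_eq_trace_of_frame` — `Σ_j σ_j² = tr(A⁻¹BA⁻¹B)` (basis-free); ★★★ `norm_gaussNormC_frame` — `‖gaussNormC M‖ = |det P|·Π_j √(2π)∕(1+σ_j²)^{¼}` and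
  `gaussNormR (Re M) = |det P|·(√(2π))^{n}`; ★★★ `gaussNormC_floor` — for `Re M ≻ 0`, `Im M` symmetric: `gaussNormC M ≠ 0`, `0 < gaussNormR (Re M)`, the real Gaussian is integrable, and
  THE SECOND-ORDER FLOOR `exp(−¼·tr((Re M)⁻¹(Im M)(Re M)⁻¹(Im M)))·gaussNormR (Re M) ≤ ‖gaussNormC M‖` (`1 + u ≤ e^{u}`).
* ASSEMBLED (§8): ★★★ `norm_gaussRatioC_le_exp_trace` — `‖gaussRatioC χ M E‖ ≤ exp(η + ¼·tr((Re M)⁻¹(Im M)(Re M)⁻¹(Im M)))`; `gaussNormC_ne_zero`; `norm_gaussRatioC_sub_one_le_trace`.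
WHY THE COMPLEX NORMALISATION IS THE RIGHT CARRIER (design remark for DEF-1∕N1): the modulus of the numerator only sees `Re M`; the modulus of the complex normalisation is SMALLER than
the real one only by `Π(1+σ_j²)^{−¼} ≥ e^{−¼Σσ_j²}` — SECOND order in `Im M` — whereas a fixed real normalisation would pay the FIRST-order shift `det(A + Re δM)∕det A`.
CONSUMER (N4-R of ◇ v13.2∕v13.3, FE-2 of ⟨27930⟩): with `M := piecesFormC … (recordSWeight … s) ψ`, `χ := chiRem …`, the model owes FOUR faces in its own currency — (F-coer) `Re M(s,ψ) ≻ 0`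
on `cpoly(e^{κ₁}) × recordUc` (coercivity margin (E3)), (F-im) the Hilbert–Schmidt budget `tr((Re M)⁻¹(Im M)(Re M)⁻¹(Im M)) ≤ 4θ·|c|`, (F-int) `Re E ≤ η·|c|` on `supp χ`, (F-tail) the cut-off
tail budget `T` — and then `c_R := η + θ`; NONE of them is asserted here.

HONEST FRAMING.  Mathlib-only theorems about parametric Gaussian integrals over `ι → ℝ`; junk discipline ◆ (R-a) respected (layer 1 ASSUMES the regime where used, layer 2 PROVES
non-vanishing∕positivity∕integrability under `Re M ≻ 0`; no `def … : Prop` letter).  Nothing of Bałaban is asserted, ported or discharged; the four MODEL faces and the holomorphy half of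
N4-R are NOT here; `stub_FE`∕`stub_P0C` OPEN, ⟨27930⟩ OPEN; K0⁷∕K0ᴬ∕K1ᴬ∕K3ᴬ OPEN; NODE O 0∕1; finite `𝕋⁴_{L^K}` at fixed ε — NOT continuum∕OS; **the Yang–Mills mass gap (Clay) is NOT
proved by any of this.**  No `sorry`, `instance`, `notation`, `structure`, `private`; standard axioms.
-/

noncomputable section

open scoped BigOperators
open MeasureTheory Complex

namespace Summit.QuantumFields.YangMills.Theorems.K0AxComplexGaussianRatio

open Summit.QuantumFields.YangMills.Theorems.K0RecordFormatNames (quadC gaussIntC gaussNormC gaussRatioC)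

variable {ι : Type*} [Fintype ι]

/-! ## §7  LAYER 2c — THE DENOMINATOR: exact modulus, non-vanishing, positivity of the real Gaussian, and the SECOND-ORDER floor `e^{−¼ tr(A⁻¹BA⁻¹B)}` -/

section Denominator

open Matrix

variable [DecidableEq ι]

/-- In a frame for `(Re M, Im M)`, `½·quadC M (P w) = Σ_j ½(1 + σ_j i)·w_j²`. [cite: Balaban1988RG2Cluster, (1.9)–(1.10) p.4 (bookkeeping)] -/
theorem half_quadC_frame (M : Matrix ι ι ℂ) (P : Matrix ι ι ℝ) (σ : ι → ℝ)
    (h1 : Pᵀ * M.map Complex.re * P = 1) (h2 : Pᵀ * M.map Complex.im * P = Matrix.diagonal σ) (w : ι → ℝ) :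
    (1 / 2 : ℂ) * quadC M (P *ᵥ w) = ∑ j, ((1 + (σ j : ℂ) * Complex.I) / 2) * (w j : ℂ) ^ 2 := by
  rw [quadC_eq_re_add_im, quadFormR_mulVec, quadFormR_mulVec, h1, h2, quadFormR_one, quadFormR_diagonal]
  push_cast
  rw [Finset.sum_mul, ← Finset.sum_add_distrib, Finset.mul_sum]
  exact Finset.sum_congr rfl fun j _ => by ring

/-- The real case: `½·quadC (Re M) (P w) = Σ_j ½·w_j²`. [cite: Balaban1987RG1, (2.12) p.268 (bookkeeping)] -/
theorem half_quadC_frame_real (A P : Matrix ι ι ℝ) (h1 : Pᵀ * A * P = 1) (w : ι → ℝ) :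
    (1 / 2 : ℂ) * quadC (A.map ((↑) : ℝ → ℂ)) (P *ᵥ w) = ∑ j, (1 / 2 : ℂ) * (w j : ℂ) ^ 2 := by
  rw [quadC_map_ofReal, quadFormR_mulVec, h1, quadFormR_one]
  push_cast
  rw [Finset.mul_sum]

/-- The modulus of the one-dimensional complex Gaussian factor: `‖(π ∕ ((1 + σi)∕2))^{½}‖ = √(2π) ∕ (1 + σ²)^{¼}`. [cite: Brydges1986, §3 (bookkeeping)] -/
theorem norm_gaussFactorC (σ : ℝ) :
    ‖((Real.pi : ℂ) / ((1 + (σ : ℂ) * Complex.I) / 2)) ^ (1 / 2 : ℂ)‖ = Real.sqrt (2 * Real.pi) / Real.sqrt (Real.sqrt (1 + σ ^ 2)) := by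
  have hhalf : (1 / 2 : ℂ) = ((1 / 2 : ℝ) : ℂ) := by push_cast; ring
  rw [hhalf, Complex.norm_cpow_real, norm_div, norm_div, Complex.norm_real, Real.norm_eq_abs, abs_of_pos Real.pi_pos]
  have h1 : ‖(1 : ℂ) + (σ : ℂ) * Complex.I‖ = Real.sqrt (1 + σ ^ 2) := by
    rw [Complex.norm_eq_sqrt_sq_add_sq]
    congr 1
    simp
  have h2 : ‖(2 : ℂ)‖ = 2 := by simp
  rw [h1, h2, ← Real.sqrt_eq_rpow, ← Real.sqrt_div (by positivity : (0 : ℝ) ≤ 2 * Real.pi)]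
  congr 1
  field_simp

/-- The real one-dimensional factor: `(π ∕ ½)^{½} = √(2π)` (as a complex number). [cite: Brydges1986, §3 (bookkeeping)] -/
theorem gaussFactor_real : ((Real.pi : ℂ) / (1 / 2 : ℂ)) ^ (1 / 2 : ℂ) = ((Real.sqrt (2 * Real.pi) : ℝ) : ℂ) := by
  have hhalf : (1 / 2 : ℂ) = ((1 / 2 : ℝ) : ℂ) := by push_cast; ring
  have hbase : (Real.pi : ℂ) / (1 / 2 : ℂ) = ((2 * Real.pi : ℝ) : ℂ) := by push_cast; ring
  rw [hbase, hhalf, ← Complex.ofReal_cpow (by positivity : (0 : ℝ) ≤ 2 * Real.pi), ← Real.sqrt_eq_rpow]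

/-- `1 ∕ (1 + u)^{¼} ≥ e^{−u∕4}` for `u ≥ 0` — from `1 + u ≤ e^{u}`. [cite: Brydges1986, §3 (bookkeeping)] -/
theorem exp_neg_quarter_mul_le_inv_sqrt_sqrt (u : ℝ) (hu : 0 ≤ u) : Real.exp (-(1 / 4 : ℝ) * u) ≤ (Real.sqrt (Real.sqrt (1 + u)))⁻¹ := by
  have h1 : Real.sqrt (Real.sqrt (1 + u)) ≤ Real.exp ((1 / 4 : ℝ) * u) := by
    have hq : Real.exp ((1 / 4 : ℝ) * u) = Real.sqrt (Real.sqrt (Real.exp u)) := by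
      rw [Real.sqrt_eq_rpow, Real.sqrt_eq_rpow, ← Real.exp_mul, ← Real.exp_mul]
      congr 1; ring
    rw [hq]
    exact Real.sqrt_le_sqrt (Real.sqrt_le_sqrt (by linarith [Real.add_one_le_exp u]))
  have hpos : 0 < Real.sqrt (Real.sqrt (1 + u)) := Real.sqrt_pos.2 (Real.sqrt_pos.2 (by linarith))
  rw [show -(1 / 4 : ℝ) * u = -((1 / 4 : ℝ) * u) by ring, Real.exp_neg]
  exact inv_anti₀ hpos h1

/-- ★★★ **LAYER 2c — THE DENOMINATOR IN CLOSED MODULUS FORM, IN ANY FRAME**: for a complex matrix `M` at real points with `A := Re M`, `B := Im M` and a frame `Pᵀ A P = 1`, `Pᵀ B P = diagonal σ`: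
`‖gaussNormC M‖ = |det P|·Π_j √(2π)∕(1 + σ_j²)^{¼}` and `gaussNormR A = |det P|·Π_j √(2π)` — the imaginary part lowers the modulus only at SECOND order in `σ`.
[cite: Balaban1988RG2Cluster, (1.13)–(1.14) p.5; Brydges1986, §3] -/
theorem norm_gaussNormC_frame (M : Matrix ι ι ℂ) (P : Matrix ι ι ℝ) (σ : ι → ℝ)
    (h1 : Pᵀ * M.map Complex.re * P = 1) (h2 : Pᵀ * M.map Complex.im * P = Matrix.diagonal σ) :
    ‖gaussNormC M‖ = |P.det| * ∏ j, Real.sqrt (2 * Real.pi) / Real.sqrt (Real.sqrt (1 + σ j ^ 2))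
    ∧ gaussNormR (M.map Complex.re) = |P.det| * ∏ _j : ι, Real.sqrt (2 * Real.pi) := by
  have hP : P.det ≠ 0 := (det_sq_mul_det_of_frame _ P h1).2
  set b : ι → ℂ := fun j => (1 + (σ j : ℂ) * Complex.I) / 2 with hb
  have hbre : ∀ j, 0 < (b j).re := by intro j; simp [hb]
  have eqC := gaussNormC_eq_of_frame M P hP b hbre (half_quadC_frame M P σ h1 h2)
  have eqR := gaussNormC_eq_of_frame ((M.map Complex.re).map ((↑) : ℝ → ℂ)) P hP (fun _ => (1 / 2 : ℂ)) (fun _ => by norm_num)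
    (half_quadC_frame_real (M.map Complex.re) P h1)
  rw [gaussNormC_map_ofReal] at eqR
  constructor
  · rw [eqC, norm_mul, Complex.norm_real, Real.norm_eq_abs, abs_abs, norm_prod]
    congr 1
    exact Finset.prod_congr rfl fun j _ => norm_gaussFactorC (σ j)
  · rw [Finset.prod_const]
    simp only [gaussFactor_real, Finset.prod_const] at eqR
    exact_mod_cast eqR

/-- ★★★ **THE CGRS DENOMINATOR BRICK** (what layer 1's `τ` IS): for a complex matrix `M` at real points with `Re M ≻ 0` (positive definite, symmetric) and `Im M` symmetric,
(i) `gaussNormC M ≠ 0`; (ii) `0 < gaussNormR (Re M)`; (iii) the real Gaussian of `Re M` is integrable; (iv) the SECOND-ORDER FLOOR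
`exp(−¼·tr((Re M)⁻¹(Im M)(Re M)⁻¹(Im M)))·gaussNormR (Re M) ≤ ‖gaussNormC M‖` (`tr(A⁻¹BA⁻¹B) = Σ_j σ_j² = ‖A^{−½}BA^{−½}‖²_HS`).
[cite: Balaban1988RG2Cluster, (1.13)–(1.14) p.5; Brydges1986, §3] -/
theorem gaussNormC_floor (M : Matrix ι ι ℂ) (hA : (M.map Complex.re).PosDef) (hB : (M.map Complex.im).IsSymm) :
    gaussNormC M ≠ 0 ∧ 0 < gaussNormR (M.map Complex.re)
    ∧ Integrable (fun x : ι → ℝ => Real.exp (-(1 / 2 : ℝ) * quadFormR (M.map Complex.re) x))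
    ∧ Real.exp (-(1 / 4 : ℝ) * ((M.map Complex.re)⁻¹ * M.map Complex.im * (M.map Complex.re)⁻¹ * M.map Complex.im).trace)
        * gaussNormR (M.map Complex.re) ≤ ‖gaussNormC M‖ := by
  obtain ⟨P, σ, h1, h2⟩ := exists_congruenceFrame (M.map Complex.re) (M.map Complex.im) hA hB
  have hP : P.det ≠ 0 := (det_sq_mul_det_of_frame _ P h1).2
  obtain ⟨eqC, eqR⟩ := norm_gaussNormC_frame M P σ h1 h2
  have hdetpos : 0 < |P.det| := abs_pos.2 hP
  have hRpos : 0 < gaussNormR (M.map Complex.re) := by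
    rw [eqR]; exact mul_pos hdetpos (Finset.prod_pos fun _ _ => Real.sqrt_pos.2 (by positivity))
  have hfloor : Real.exp (-(1 / 4 : ℝ) * ((M.map Complex.re)⁻¹ * M.map Complex.im * (M.map Complex.re)⁻¹ * M.map Complex.im).trace)
      * gaussNormR (M.map Complex.re) ≤ ‖gaussNormC M‖ := by
    rw [← sum_sq_eq_trace_of_frame _ _ P σ h1 h2, eqC, eqR, Finset.mul_sum, Real.exp_sum, mul_left_comm, ← Finset.prod_mul_distrib]
    refine mul_le_mul_of_nonneg_left (Finset.prod_le_prod (fun j _ => by positivity) fun j _ => ?_) hdetpos.le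
    have hj := exp_neg_quarter_mul_le_inv_sqrt_sqrt (σ j ^ 2) (sq_nonneg _)
    calc Real.exp (-(1 / 4 : ℝ) * σ j ^ 2) * Real.sqrt (2 * Real.pi)
        = Real.sqrt (2 * Real.pi) * Real.exp (-(1 / 4 : ℝ) * σ j ^ 2) := mul_comm _ _
      _ ≤ Real.sqrt (2 * Real.pi) * (Real.sqrt (Real.sqrt (1 + σ j ^ 2)))⁻¹ := mul_le_mul_of_nonneg_left hj (Real.sqrt_nonneg _)
      _ = Real.sqrt (2 * Real.pi) / Real.sqrt (Real.sqrt (1 + σ j ^ 2)) := (div_eq_mul_inv _ _).symm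
  refine ⟨?_, hRpos, integrable_gaussR_of_frame _ P hP h1, hfloor⟩
  have : 0 < ‖gaussNormC M‖ := lt_of_lt_of_le (mul_pos (Real.exp_pos _) hRpos) hfloor
  exact norm_pos_iff.1 this

end Denominator

/-! ## §8  THE ASSEMBLED BRICK (layer 1 + layer 2): N4-R's two absolute-value clauses with `τ := ¼·tr(A⁻¹BA⁻¹B)` -/

section Assembled

variable [DecidableEq ι]

/-- ★★★ **CGRS (iii) ASSEMBLED — `|R| ≤ e^{η + ¼tr(A⁻¹BA⁻¹B)}`**: for `M` with `Re M ≻ 0`, `Im M` symmetric, a cut-off `0 ≤ χ ≤ 1` and an exponent with `Re E ≤ η` on `{χ ≠ 0}`: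
`‖gaussRatioC χ M E‖ ≤ exp(η + ¼·tr((Re M)⁻¹(Im M)(Re M)⁻¹(Im M)))`.  N4-R's `|R_c(s,ψ)| ≤ e^{c_R|c|}` follows once the MODEL faces give `η ≤ η_□|c|` and `tr(…) ≤ 4θ_□|c|`
(hands' currency: coercivity margin + imaginary-part Hilbert–Schmidt budget of `piecesFormC` on the polydisc). [cite: Balaban1988RG2Cluster, (1.13)–(1.14) p.5; Brydges1986, §3] -/
theorem norm_gaussRatioC_le_exp_trace (χ : (ι → ℝ) → ℝ) (M : Matrix ι ι ℂ) (E : (ι → ℝ) → ℂ) (η : ℝ)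
    (hA : (M.map Complex.re).PosDef) (hB : (M.map Complex.im).IsSymm)
    (hχ : ∀ x, 0 ≤ χ x ∧ χ x ≤ 1) (hE : ∀ x, χ x ≠ 0 → (E x).re ≤ η) :
    ‖gaussRatioC χ M E‖
      ≤ Real.exp (η + (1 / 4 : ℝ) * ((M.map Complex.re)⁻¹ * M.map Complex.im * (M.map Complex.re)⁻¹ * M.map Complex.im).trace) := by
  obtain ⟨-, hpos, hint, hfloor⟩ := gaussNormC_floor M hA hB
  refine norm_gaussRatioC_le_exp χ M E η _ hχ hE hint hpos ?_
  convert hfloor using 3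
  ring

/-- ★★★ **CGRS (i) ASSEMBLED — the normalisation does not vanish on `{Re M ≻ 0}`** (so DEF-1's `gaussRatioC` is a genuine quotient there, ◆ (R-a)). [cite: Balaban1987RG1, (2.12) p.268; Brydges1986, §3] -/
theorem gaussNormC_ne_zero (M : Matrix ι ι ℂ) (hA : (M.map Complex.re).PosDef) (hB : (M.map Complex.im).IsSymm) : gaussNormC M ≠ 0 :=
  (gaussNormC_floor M hA hB).1

/-- ★★★ **CGRS (iv) ASSEMBLED — `|R − 1| ≤ e^{¼tr(A⁻¹BA⁻¹B)}·(η₁ + T)`** (the `|c| = 1` clause of N4-R). [cite: Balaban1988RG2Cluster, (1.7)–(1.10) p.4; Balaban1987RG1, (2.9) p.266] -/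
theorem norm_gaussRatioC_sub_one_le_trace (χ : (ι → ℝ) → ℝ) (M : Matrix ι ι ℂ) (E : (ι → ℝ) → ℂ) (η₁ T : ℝ)
    (hA : (M.map Complex.re).PosDef) (hB : (M.map Complex.im).IsSymm)
    (hχ : ∀ x, 0 ≤ χ x ∧ χ x ≤ 1) (hη₁ : 0 ≤ η₁) (hE : ∀ x, χ x ≠ 0 → ‖Complex.exp (E x) - 1‖ ≤ η₁)
    (hnum : Integrable (fun x : ι → ℝ => (χ x : ℂ) * Complex.exp (-(1 / 2 : ℂ) * quadC M x + E x)))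
    (hden_int : Integrable (fun x : ι → ℝ => Complex.exp (-(1 / 2 : ℂ) * quadC M x)))
    (htail_int : Integrable (fun x : ι → ℝ => (1 - χ x) * Real.exp (-(1 / 2 : ℝ) * quadFormR (M.map Complex.re) x)))
    (htail : ∫ x : ι → ℝ, (1 - χ x) * Real.exp (-(1 / 2 : ℝ) * quadFormR (M.map Complex.re) x) ≤ T * gaussNormR (M.map Complex.re)) :
    ‖gaussRatioC χ M E - 1‖
      ≤ Real.exp ((1 / 4 : ℝ) * ((M.map Complex.re)⁻¹ * M.map Complex.im * (M.map Complex.re)⁻¹ * M.map Complex.im).trace) * (η₁ + T) := by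
  obtain ⟨-, hpos, -, hfloor⟩ := gaussNormC_floor M hA hB
  refine norm_gaussRatioC_sub_one_le χ M E η₁ _ T hχ hη₁ hE hnum hden_int htail_int htail hpos ?_
  convert hfloor using 3
  ring

end Assembled

end Summit.QuantumFields.YangMills.Theorems.K0AxComplexGaussianRatio

end
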